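/-
Copyright: b2b-lace packet (explicit-unit carver, gen 18).  The HYPEROCTAHEDRAL CLASS COUNT: the number of
points of `ℤ^d` with a prescribed absolute-value profile `(N₀, N₁, …, N_r)` (`N_j` coordinates of absolute
value `j`, `Σ N_j = d`) is `binom(d; N) · 2^{d−N₀} = 2^k · d!/(d−k)! / ∏_{j≥1} N_j!` (`k = d − N₀` non-zero
coordinates) — the orbit size `|O_d(v)|` by which the engines regroup `Σ_{x ∈ ℤ^d}` into a sum over classes.
Pure combinatorics; no numerals, no dimension; nothing of the record is touched.
-/
import Mathlib.Data.Fintype.BigOperators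
import Mathlib.Data.Nat.Factorial.Basic
import Literature.Probability.LatticeModels.LatticeGraph
import Literature.Computability.AlgebraicComplexity.MultinomialWords
import HarnessLib

/-!
# Lattice point classes: the hyperoctahedral orbit count

CITATION HEADER (PLACEMENT v2). This module is part of a certified REPRODUCTION of:
R. Fitzner, R. van der Hofstad, *Mean-field behavior for nearest-neighbor percolation in d > 10*,
Electron. J. Probab. 22 (2017), no. 43, 1–65 [FvdH17], and *Generalized approach to the non-backtracking
lace expansion*, Probab. Theory Related Fields 169 (2017), 1041–1119 [NoBLE17-I] (arXiv:1506.07977, 1506.07969).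
Reproduces: the regrouping of the sum "over all `x ∈ ℤ^d`" in the explicit computation of `(a_i ⊗ H_z)(0)`
([NoBLE17-I] §5.3.3) into a sum over SYMMETRY CLASSES of end-points, as the accompanying notebooks do (a class
= the multiset of non-zero absolute values of the coordinates; its size is the hyperoctahedral orbit size
`|O_d(v)| = 2^k · d!/(d−k)! / ∏_j N_j!`, the tree's NUMBER `Stage1CellsRec.V.orbit`, D46-SPEC F2) — here as a
kernel COUNTING THEOREM for an arbitrary profile, via the tree's "number of words with prescribed letter counts
= multinomial coefficient" (`MultinomialWords.card_words_eq_multinomial`, [BCS97] Thm. 15.41).  Origin: build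
`lace`, node N67-W (leaf feeding N67-S3, the class regrouping of the weighted-bubble cell) of `LEMMAS.md`.

## What is here

* `absCount x j` — the number of coordinates of `x : ℤ^d` of absolute value `j`;
* `pointClass d r N` — the finite set of points of `ℤ^d` with level word in `Fin d → Fin (r+1)` of letter
  counts `N` (built constructively from level words and admissible sign patterns), with the membership
  characterisations `mem_pointClass` (`↔ (∀ μ, |x_μ| ≤ r) ∧ ∀ j ≤ r, absCount x j = N j`) and, when
  `Σ_j N_j = d`, `mem_pointClass_iff` (`↔ ∀ j ≤ r, absCount x j = N j`);
* `card_pointClass` — `#pointClass d r N = binom(d; N) · 2^{d − N₀}` (`Nat.multinomial`), and the engines'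
  form `card_pointClass_mul_prod_factorial` / `card_pointClass_eq_div`:
  `#pointClass · ∏_{j=1}^{r} N_j! = 2^{d−N₀} · d.descFactorial (d−N₀)`, i.e.
  `#pointClass = 2^k · d!/(d−k)! / ∏_{j≥1} N_j!` with `k = d − N₀`.

## What is NOT here

No enumeration of self-avoiding-walk end-point classes (`c_i(v)`), no link to `Stage1CellsRec.V` (that
dictionary is one `rfl`-level line per constructor for the typer); no numerals.  No cited fact, no named
hypothesis, no `sorry`.

## References
* [NoBLE17-I] R. Fitzner, R. van der Hofstad, Generalized approach to the non-backtracking lace expansion,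
  Probab. Theory Relat. Fields 169 (2017) 1041–1119; arXiv:1506.07969 — §5.3.3.
* [BCS97] P. Bürgisser, M. Clausen, M. A. Shokrollahi, Algebraic Complexity Theory, Springer 1997 — Thm. 15.41
  (proof, p. 381: `|I_μ| = binom(N; μ)`), the tree's `MultinomialWords`.
-/

namespace Literature.Probability.FitznerVanDerHofstad2017

open Finset Literature.Probability.LatticeModels

variable {d r : ℕ}

/-! ### Profiles, level words, sign patterns -/

/-- The number of coordinates of `x ∈ ℤ^d` of absolute value `j`. [folklore] -/
def absCount (x : Site d) (j : ℕ) : ℕ := (univ.filter fun μ : Fin d => (x μ).natAbs = j).card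

/-- The point of `ℤ^d` with absolute values (levels) `w` and signs `s` (`true` = non-negative). [folklore] -/
def signedPoint (w : Fin d → Fin (r + 1)) (s : Fin d → Bool) : Site d :=
  fun μ => if s μ then ((w μ : ℕ) : ℤ) else -((w μ : ℕ) : ℤ)

/-- The level words `Fin d → Fin (r+1)` with letter counts `N`. [folklore] -/
def levelWords (d r : ℕ) (N : Fin (r + 1) → ℕ) : Finset (Fin d → Fin (r + 1)) :=
  univ.filter fun w => ∀ j, (univ.filter fun μ => w μ = j).card = N j

/-- The admissible sign patterns of a level word: the sign is forced (`true`) on the zero coordinates.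
[folklore] -/
def signPatterns (w : Fin d → Fin (r + 1)) : Finset (Fin d → Bool) :=
  Fintype.piFinset fun μ => if w μ = 0 then {true} else univ

/-- **The class of points of `ℤ^d` with absolute-value profile `N`** (`N j` coordinates of absolute value
`j ≤ r`), as a finite set: the signed points of the level words of counts `N`. [folklore] -/
def pointClass (d r : ℕ) (N : Fin (r + 1) → ℕ) : Finset (Site d) :=
  ((levelWords d r N).sigma fun w => signPatterns w).image fun p => signedPoint p.1 p.2

/-- Membership in the level words of counts `N`. [folklore] -/
theorem mem_levelWords {N : Fin (r + 1) → ℕ} {w : Fin d → Fin (r + 1)} :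
    w ∈ levelWords d r N ↔ ∀ j, (univ.filter fun μ => w μ = j).card = N j := by
  simp [levelWords]

/-- Membership in the admissible sign patterns: `true` on the zero coordinates. [folklore] -/
theorem mem_signPatterns {w : Fin d → Fin (r + 1)} {s : Fin d → Bool} :
    s ∈ signPatterns w ↔ ∀ μ, w μ = 0 → s μ = true := by
  simp only [signPatterns, Fintype.mem_piFinset]
  refine forall_congr' fun μ => ?_
  by_cases h : w μ = 0 <;> simp [h]

/-- `|signedPoint w s μ| = w μ`. [folklore] -/
@[simp] theorem natAbs_signedPoint (w : Fin d → Fin (r + 1)) (s : Fin d → Bool) (μ : Fin d) :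
    (signedPoint w s μ).natAbs = (w μ : ℕ) := by
  unfold signedPoint
  split <;> simp

/-- The profile of a signed point is the letter count of its level word. [folklore] -/
theorem absCount_signedPoint (w : Fin d → Fin (r + 1)) (s : Fin d → Bool) (j : Fin (r + 1)) :
    absCount (signedPoint w s) j = (univ.filter fun μ => w μ = j).card := by
  unfold absCount
  congr 1
  ext μ
  simp only [mem_filter, mem_univ, true_and, natAbs_signedPoint]
  exact Fin.val_inj

/-! ### Membership -/

/-- **Membership in a class**: `x ∈ pointClass d r N` iff every coordinate has absolute value `≤ r` and
the profile of `x` is `N`. [folklore] -/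
theorem mem_pointClass {N : Fin (r + 1) → ℕ} {x : Site d} :
    x ∈ pointClass d r N ↔ (∀ μ, (x μ).natAbs ≤ r) ∧ ∀ j : Fin (r + 1), absCount x j = N j := by
  constructor
  · intro hx
    obtain ⟨⟨w, s⟩, hp, rfl⟩ := mem_image.1 hx
    obtain ⟨hw, -⟩ := mem_sigma.1 hp
    refine ⟨fun μ => ?_, fun j => ?_⟩
    · rw [natAbs_signedPoint]; exact Nat.lt_succ_iff.1 (w μ).2
    · rw [absCount_signedPoint]; exact mem_levelWords.1 hw j
  · rintro ⟨hr, hN⟩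
    let w : Fin d → Fin (r + 1) := fun μ => ⟨(x μ).natAbs, Nat.lt_succ_of_le (hr μ)⟩
    let s : Fin d → Bool := fun μ => decide (0 ≤ x μ)
    have hws : ∀ j : Fin (r + 1),
        (univ.filter fun μ => w μ = j) = univ.filter fun μ => (x μ).natAbs = j := by
      intro j; ext μ
      simp only [mem_filter, mem_univ, true_and, w, Fin.ext_iff]
    refine mem_image.2 ⟨⟨w, s⟩, mem_sigma.2 ⟨?_, ?_⟩, ?_⟩
    · exact mem_levelWords.2 fun j => by rw [hws j]; exact hN j
    · refine mem_signPatterns.2 fun μ hμ => ?_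
      have h0 : (x μ).natAbs = 0 := by simpa [w, Fin.ext_iff] using hμ
      have : x μ = 0 := Int.natAbs_eq_zero.1 h0
      simp [s, this]
    · funext μ
      show (if s μ then (((x μ).natAbs : ℕ) : ℤ) else -(((x μ).natAbs : ℕ) : ℤ)) = x μ
      by_cases h : 0 ≤ x μ
      · have hs : s μ = true := by simp [s, h]
        rw [if_pos hs]
        exact Int.natAbs_of_nonneg h
      · have hs : s μ = false := by simp [s, h]
        rw [hs, if_neg Bool.false_ne_true, Int.ofNat_natAbs_of_nonpos (le_of_lt (not_le.1 h)), neg_neg]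

/-- If the profile counts `N j`, `j ≤ r`, already add up to `d`, then every coordinate has absolute value
`≤ r` (the fibres exhaust the `d` coordinates). [folklore] -/
theorem natAbs_le_of_absCount {N : Fin (r + 1) → ℕ} (hN : ∑ j, N j = d) {x : Site d}
    (hx : ∀ j : Fin (r + 1), absCount x j = N j) (μ : Fin d) : (x μ).natAbs ≤ r := by
  refine Nat.le_of_not_lt fun hμ => ?_
  -- the fibres over `j ≤ r` are pairwise disjoint subsets of `univ.erase μ`
  let F : Fin (r + 1) → Finset (Fin d) := fun j => univ.filter fun ν => (x ν).natAbs = j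
  have hdisj : Set.PairwiseDisjoint (↑(univ : Finset (Fin (r + 1)))) F := by
    intro i _ j _ hij
    refine disjoint_filter.2 fun ν _ hi hj => hij (Fin.ext ?_)
    rw [← hi, ← hj]
  have hsub : (univ : Finset (Fin (r + 1))).biUnion F ⊆ univ.erase μ := by
    intro ν hν
    obtain ⟨j, -, hj⟩ := mem_biUnion.1 hν
    refine mem_erase.2 ⟨?_, mem_univ ν⟩
    rintro rfl
    have : (x ν).natAbs = j := (mem_filter.1 hj).2
    have hj' : (j : ℕ) ≤ r := Nat.lt_succ_iff.1 j.2
    omega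
  have hcard : ∑ j, N j ≤ d - 1 := by
    calc ∑ j, N j = ∑ j, (F j).card := sum_congr rfl fun j _ => (hx j).symm
      _ = ((univ : Finset (Fin (r + 1))).biUnion F).card := (card_biUnion hdisj).symm
      _ ≤ (univ.erase μ).card := card_le_card hsub
      _ = d - 1 := by rw [card_erase_of_mem (mem_univ μ), card_univ, Fintype.card_fin]
  have hd : 0 < d := Fin.pos μ
  omega

/-- **Membership by profile alone** when `Σ_j N_j = d`. [folklore] -/
theorem mem_pointClass_iff {N : Fin (r + 1) → ℕ} (hN : ∑ j, N j = d) {x : Site d} :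
    x ∈ pointClass d r N ↔ ∀ j : Fin (r + 1), absCount x j = N j :=
  mem_pointClass.trans ⟨fun h => h.2, fun h => ⟨natAbs_le_of_absCount hN h, h⟩⟩

/-! ### Counting -/

/-- Distinct (level word, admissible sign pattern) pairs give distinct points. [folklore] -/
theorem signedPoint_injOn (N : Fin (r + 1) → ℕ) :
    Set.InjOn (fun p : (Σ _ : Fin d → Fin (r + 1), Fin d → Bool) => signedPoint p.1 p.2)
      ↑((levelWords d r N).sigma fun w => signPatterns w) := by
  rintro ⟨w, s⟩ hp ⟨w', s'⟩ hq h
  have hs : ∀ μ, w μ = 0 → s μ = true := mem_signPatterns.1 (mem_sigma.1 (mem_coe.1 hp)).2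
  have hs' : ∀ μ, w' μ = 0 → s' μ = true := mem_signPatterns.1 (mem_sigma.1 (mem_coe.1 hq)).2
  have hμ : ∀ μ, signedPoint w s μ = signedPoint w' s' μ := fun μ => congrFun h μ
  have hw : w = w' := by
    funext μ
    apply Fin.ext
    have := congrArg Int.natAbs (hμ μ)
    simpa using this
  subst hw
  have hss : s = s' := by
    funext μ
    by_cases h0 : w μ = 0
    · rw [hs μ h0, hs' μ h0]
    · have hne : ((w μ : ℕ) : ℤ) ≠ 0 := by
        have : (w μ : ℕ) ≠ 0 := fun h => h0 (Fin.ext h)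
        exact_mod_cast this
      have e := hμ μ
      simp only [signedPoint] at e
      cases hsm : s μ <;> cases hsm' : s' μ <;> simp [hsm, hsm'] at e ⊢ <;> omega
  subst hss
  rfl

/-- The number of admissible sign patterns of a level word is `2^{#non-zero letters}`. [folklore] -/
theorem card_signPatterns (w : Fin d → Fin (r + 1)) :
    (signPatterns w).card = 2 ^ (univ.filter fun μ => w μ ≠ 0).card := by
  rw [signPatterns, Fintype.card_piFinset]
  simp only [apply_ite Finset.card, card_singleton, card_univ, Fintype.card_bool]
  rw [prod_ite, prod_const_one, one_mul, prod_const]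

/-- A level word of counts `N` has `d − N 0` non-zero letters. [folklore] -/
theorem card_ne_zero_of_mem_levelWords {N : Fin (r + 1) → ℕ} {w : Fin d → Fin (r + 1)}
    (hw : w ∈ levelWords d r N) : (univ.filter fun μ => w μ ≠ 0).card = d - N 0 := by
  have h0 : (univ.filter fun μ => w μ = 0).card = N 0 := mem_levelWords.1 hw 0
  have h := card_filter_add_card_filter_not (s := (univ : Finset (Fin d))) (fun μ => w μ = 0)
  rw [card_univ, Fintype.card_fin, h0] at h
  simpa using (Nat.eq_sub_of_add_eq' h)

/-- **The class count**: `#pointClass d r N = binom(d; N) · 2^{d − N₀}` for `Σ_j N_j = d`.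
[cite: FitznerVanDerHofstad2016NoBLE, §5.3.3 (the sum over all x ∈ ℤ^d regrouped by symmetry)]
[cite: BurgisserClausenShokrollahi1997, Thm. 15.41 (proof, p. 381)] -/
theorem card_pointClass (N : Fin (r + 1) → ℕ) (hN : ∑ j, N j = d) :
    (pointClass d r N).card = Nat.multinomial univ N * 2 ^ (d - N 0) := by
  rw [pointClass, card_image_of_injOn (signedPoint_injOn N), card_sigma]
  rw [sum_congr rfl fun w hw => by rw [card_signPatterns, card_ne_zero_of_mem_levelWords hw],
    sum_const, smul_eq_mul]
  congr 1
  rw [levelWords]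
  convert Literature.Computability.AlgebraicComplexity.card_words_eq_multinomial d N hN

/-- **The engines' form, multiplicative**: `#pointClass · ∏_{j=1}^{r} N_j! = 2^{d−N₀} · d!/(N₀)!`
(`d.descFactorial (d − N₀) = d!/(N₀)!`). [folklore] -/
theorem card_pointClass_mul_prod_factorial (N : Fin (r + 1) → ℕ) (hN : ∑ j, N j = d) :
    (pointClass d r N).card * ∏ j : Fin r, (N j.succ).factorial =
      2 ^ (d - N 0) * d.descFactorial (d - N 0) := by
  have hspec := Nat.multinomial_spec (univ : Finset (Fin (r + 1))) N
  rw [hN, Fin.prod_univ_succ] at hspec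
  have hN0 : N 0 ≤ d := by
    rw [← hN]; exact single_le_sum (fun _ _ => Nat.zero_le _) (mem_univ 0)
  have hdesc := Nat.factorial_mul_descFactorial (Nat.sub_le d (N 0))
  rw [Nat.sub_sub_self hN0] at hdesc
  -- `multinomial · ∏_{j ≥ 1} N_j! = d.descFactorial (d − N 0)`
  have hkey : Nat.multinomial univ N * ∏ j : Fin r, (N j.succ).factorial = d.descFactorial (d - N 0) := by
    have hpos : 0 < (N 0).factorial := Nat.factorial_pos _
    refine Nat.eq_of_mul_eq_mul_left hpos ?_
    calc (N 0).factorial * (Nat.multinomial univ N * ∏ j : Fin r, (N j.succ).factorial)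
        = ((N 0).factorial * ∏ j : Fin r, (N j.succ).factorial) * Nat.multinomial univ N := by ring
      _ = d.factorial := hspec
      _ = (N 0).factorial * d.descFactorial (d - N 0) := hdesc.symm
  rw [card_pointClass N hN, mul_right_comm, hkey, mul_comm]

/-- **The engines' form** (`Stage1CellsRec.V.orbit`: `2 ^ k * d.descFactorial k / ∏ N_j!`, `k = d − N₀`):
`#pointClass d r N = 2^{d−N₀} · d.descFactorial (d−N₀) / ∏_{j=1}^{r} N_j!`. [folklore] -/
theorem card_pointClass_eq_div (N : Fin (r + 1) → ℕ) (hN : ∑ j, N j = d) :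
    (pointClass d r N).card =
      2 ^ (d - N 0) * d.descFactorial (d - N 0) / ∏ j : Fin r, (N j.succ).factorial := by
  have hpos : 0 < ∏ j : Fin r, (N j.succ).factorial := prod_pos fun j _ => Nat.factorial_pos _
  rw [← card_pointClass_mul_prod_factorial N hN, Nat.mul_div_cancel _ hpos]

end Literature.Probability.FitznerVanDerHofstad2017
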